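/-
Copyright (c) 2026 the pub-hodgecm-mathlib formalisation cell (harness21).  Prover seat hodgecm-mathlib-K2Liu-p10 (g2), Track B «K2-LIT»,
#184♮ = hLiu418 = `stmt-HodgeConjecture-24832`; LEAD F0P6-plan (g13) RULINGS «M-157a» (1) ∕ «M-157j» (1): G5-a sub-organ (α) (the middle cell of the
constant term), file α2c — THE LEVI HOMOMORPHISM `Λ : GL_n(𝔸_L) →* H(𝔸)` (by value) AND THE RATIONAL LEVI DECOMPOSITION `P_Δ(L⁺) = N_Δ(L⁺) · Λ(GL_n(L))`.
THEOREMS ONLY (no `def`, no `instance`, no named-fact hypothesis, no `sorry`).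
-/
import Summits.HodgeConjecture.HodgeConjecture.Theorems.K2LiuSiegelLeviConjUnipDeltaChar
import Summits.HodgeConjecture.HodgeConjecture.Theorems.K2LiuSiegelDoubledRationalFrames
import HarnessLib

/-!
# Crux `HLiu418`, ROAD Φ, (α) file α2c: THE LEVI HOMOMORPHISM IN THE TRIANGULAR FRAME AND THE RATIONAL LEVI DECOMPOSITION

Cell `hodgecm-mathlib`, crux item hLiu418 = `stmt-HodgeConjecture-24832` (helper lane, count-neutral).  ★ `K2LiuSiegelDoubledLeviMatrix.exists_leviHom` gives
a continuous homomorphism `Λ : GL_n(𝔸_L) →* H(𝔸)` with `blk (Λ g) = R · diag(g, g♯) · R⁻¹`, `g♯ = T_𝔸⁻¹ (c(g)⁻¹)ᵀ T_𝔸` (Cayley-adapted frame).  Taking `Λ` and that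
formula BY VALUE (`hΛ`), this file records what the middle cell of the constant term needs:
* `frame_levi_apply` — the triangular frame `E₁ · blk(Λ g) · E₂ = ℓ(g, g♯) = (g, ⅟2(g − g♯); 0, g♯)` (★ `frame_levi`); `isSiegelDelta_levi_apply`,
  `deltaBlock_levi_apply` (`Λ g ∈ P_Δ(𝔸)`, `Λ g|_Δ = g`), `levi_map_mem_ratH` (`Λ ĝ ∈ H(L⁺)` for `g ∈ GL_n(L)`, ★ `mem_ratH_of_blk_eq_levi_map`);
* `mem_unipDelta_of_deltaBlock_eq_one` — a Siegel element acting trivially on `Δ` lies in `N_Δ(𝔸)` (unitarity ★ `levi_rel` forces the `𝔻∕Δ`-block);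
* **`exists_unip_mul_levi_of_rat_siegel`** ∕ **`exists_levi_mul_unip_of_rat_siegel`** — every rational Siegel `p ∈ P_Δ(L⁺)` is `ν · Λ(ĝ)` and `Λ(ĝ) · ν'`
  with `g ∈ GL_n(L)` (`ĝ` its diagonal image) and `ν, ν' ∈ N_Δ(L⁺)` (★ `exists_rat_levi_blocks`, ★ `conj_mem_unipDelta`);
* `conj_levi_mem_unipDelta` ∕ `conj_levi_mem_ratH_iff` — `Λ(x)` normalises `N_Δ(𝔸)`, and `Λ(ĝ)` preserves rationality (bookkeeping for the stabilisers
  `Λ(ĝ)⁻¹ N_χ(L⁺) Λ(ĝ)` of the middle orbits).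
Sources: [MoeglinWaldspurger1995, I.2.1, II.1.7]; [HarrisKudlaSweet1996, §1 (1.11)–(1.12)]; [GelbartPiatetskishapiroRallis1987, Part A §1].
HONEST LABEL.  Helper lemmas, count-neutral; `HC_CM` is proved only modulo the 7 printed citations (2 remaining named inputs:
hLiu418 = `stmt-HodgeConjecture-24832`, h413 = `stmt-HodgeConjecture-24833`) until rung 0 closes.
-/

set_option autoImplicit false
set_option linter.dupNamespace false -- the mandated namespace repeats `HodgeConjecture.HodgeConjecture`

noncomputable section

open scoped Matrix
open NumberField IsDedekindDomain
open Literature.NumberTheory.Automorphic Literature.NumberTheory.Automorphic.UnitaryGroup Literature.NumberTheory.GaloisRepresentations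
open Literature.NumberTheory.GelbartRogawski1991 Literature.NumberTheory.GelbartRogawski1991.GRConstruction
open Literature.NumberTheory.GelbartRogawski1991.AdaptedBlocks
open Literature.NumberTheory.K2Lit.SiegelDoubled
open UnitaryDualPair

namespace Summit.HodgeConjecture.HodgeConjecture.Cruxes.HLiu418.K2LiuSiegelRationalLeviDecomposition

open K2LiuSiegelDoubledBlkUnitary K2LiuSiegelDoubledRationalPoints K2LiuSiegelDoubledLeviMatrix K2LiuSiegelDoubledLeviAlgebra
  K2LiuSiegelDoubledRationalFrames K2LiuSiegelLeviConjUnipDeltaChar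

variable (L : Type) [Field L] [NumberField L] [IsCMField L]
variable {N M n : ℕ} (e : Fin N × Fin M ≃ Fin n)
  (dV : Fin N → L) (hdV : ∀ i, IsCMField.complexConj L (dV i) = dV i)
  (dW : Fin M → L) (hdW : ∀ i, IsCMField.complexConj L (dW i) = dW i)

/-! ## 1. Siegel elements acting trivially on `Δ` -/

/-- **A Siegel element acting trivially on `Δ` lies in `N_Δ(𝔸)`**: for `u ∈ P_Δ(𝔸)` with `u|_Δ = 1` the unitarity relation `(u|_Δ)^{c,ᵀ} T (E₁ blk u E₂)₂₂ = T`
(★ `levi_rel`) forces the `𝔻∕Δ`-block to be `1`, which is ★ `mem_unipDelta_iff_blocks`. [cite: MoeglinWaldspurger1995, I.2.1] -/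
theorem mem_unipDelta_of_deltaBlock_eq_one (hdV0 : ∀ i, dV i ≠ 0) (hdW0 : ∀ i, dW i ≠ 0) {u : HA L e dV hdV dW hdW}
    (hu : IsSiegelDelta L e dV hdV dW hdW u) (h1 : deltaBlock L e dV hdV dW hdW u = 1) : u ∈ unipDelta L e dV hdV dW hdW := by
  rw [mem_unipDelta_iff_blocks]
  refine ⟨hu, h1, ?_⟩
  have hrel := levi_rel L e dV hdV dW hdW hu
  rw [h1, Matrix.map_one _ (map_zero _) (map_one _), Matrix.transpose_one, Matrix.one_mul] at hrel
  have hT := isUnit_det_gramRA L e dV hdV dW hdW hdV0 hdW0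
  have h22 : (Matrix.fromBlocks (1 : Matrix (Fin n) (Fin n) (AdeleRing (𝓞 L) L)) 0 (-1) 1 * blk L e dV hdV dW hdW u *
      Matrix.fromBlocks 1 0 1 1).toBlocks₂₂ = 1 := by
    have h := congrArg (fun X => ((gramR L e dV hdV dW hdW).map ((algebraMap L (AdeleRing (𝓞 L) L)).comp (algebraMap (Fp L) L)))⁻¹ * X) hrel
    simp only [← Matrix.mul_assoc, Matrix.nonsing_inv_mul _ hT, Matrix.one_mul] at h
    exact h
  rwa [conjE_eq, Matrix.toBlocks_fromBlocks₂₂] at h22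

/-! ## 2. The Levi homomorphism in the triangular frame -/

section Levi

variable (Λ : GL (Fin n) (AdeleRing (𝓞 L) L) →* HA L e dV hdV dW hdW)
  (hΛ : ∀ g : GL (Fin n) (AdeleRing (𝓞 L) L), blk L e dV hdV dW hdW (Λ g) =
    cayR (AdeleRing (𝓞 L) L) (Fin n) * Matrix.fromBlocks (g : Matrix (Fin n) (Fin n) (AdeleRing (𝓞 L) L)) 0 0
      (((gramR L e dV hdV dW hdW).map ((algebraMap L (AdeleRing (𝓞 L) L)).comp (algebraMap (Fp L) L)))⁻¹ *
        (((g⁻¹ : GL (Fin n) (AdeleRing (𝓞 L) L)) : Matrix (Fin n) (Fin n) (AdeleRing (𝓞 L) L)).map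
          (conjAdele (Fp L) L (IsCMField.complexConj L)))ᵀ *
        (gramR L e dV hdV dW hdW).map ((algebraMap L (AdeleRing (𝓞 L) L)).comp (algebraMap (Fp L) L))) *
      cayRinv (AdeleRing (𝓞 L) L) (Fin n))

include hΛ in
/-- **The triangular frame of `Λ g` is the Levi frame `ℓ(g, g♯) = (g, ⅟2(g − g♯); 0, g♯)`** (★ `frame_levi`). [cite: HarrisKudlaSweet1996, §1 (1.11)] -/
theorem frame_levi_apply (g : GL (Fin n) (AdeleRing (𝓞 L) L)) :
    Matrix.fromBlocks (1 : Matrix (Fin n) (Fin n) (AdeleRing (𝓞 L) L)) 0 (-1) 1 * blk L e dV hdV dW hdW (Λ g) * Matrix.fromBlocks 1 0 1 1 =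
      Matrix.fromBlocks (g : Matrix (Fin n) (Fin n) (AdeleRing (𝓞 L) L))
        ((⅟ (2 : AdeleRing (𝓞 L) L)) • ((g : Matrix (Fin n) (Fin n) (AdeleRing (𝓞 L) L)) -
          ((gramR L e dV hdV dW hdW).map ((algebraMap L (AdeleRing (𝓞 L) L)).comp (algebraMap (Fp L) L)))⁻¹ *
            (((g⁻¹ : GL (Fin n) (AdeleRing (𝓞 L) L)) : Matrix (Fin n) (Fin n) (AdeleRing (𝓞 L) L)).map
              (conjAdele (Fp L) L (IsCMField.complexConj L)))ᵀ *
            (gramR L e dV hdV dW hdW).map ((algebraMap L (AdeleRing (𝓞 L) L)).comp (algebraMap (Fp L) L))))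
        0
        (((gramR L e dV hdV dW hdW).map ((algebraMap L (AdeleRing (𝓞 L) L)).comp (algebraMap (Fp L) L)))⁻¹ *
          (((g⁻¹ : GL (Fin n) (AdeleRing (𝓞 L) L)) : Matrix (Fin n) (Fin n) (AdeleRing (𝓞 L) L)).map
            (conjAdele (Fp L) L (IsCMField.complexConj L)))ᵀ *
          (gramR L e dV hdV dW hdW).map ((algebraMap L (AdeleRing (𝓞 L) L)).comp (algebraMap (Fp L) L))) := by
  rw [hΛ g]
  exact frame_levi _ _

include hΛ in
/-- `Λ g ∈ P_Δ(𝔸)` (★ `isSiegelDelta_of_blk_eq_levi`). [cite: HarrisKudlaSweet1996, §1 (1.11)] -/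
theorem isSiegelDelta_levi_apply (g : GL (Fin n) (AdeleRing (𝓞 L) L)) : IsSiegelDelta L e dV hdV dW hdW (Λ g) :=
  isSiegelDelta_of_blk_eq_levi L e dV hdV dW hdW (hΛ g)

include hΛ in
/-- `(Λ g)|_Δ = g` (★ `deltaBlock_of_blk_eq_levi`). [cite: HarrisKudlaSweet1996, §1 (1.11)] -/
theorem deltaBlock_levi_apply (g : GL (Fin n) (AdeleRing (𝓞 L) L)) :
    deltaBlock L e dV hdV dW hdW (Λ g) = (g : Matrix (Fin n) (Fin n) (AdeleRing (𝓞 L) L)) :=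
  deltaBlock_of_blk_eq_levi L e dV hdV dW hdW (hΛ g)

include hΛ in
/-- **`Λ ĝ ∈ H(L⁺)` for `g ∈ GL_n(L)`** (`ĝ` = the diagonal image; ★ `mem_ratH_of_blk_eq_levi_map`). [cite: MoeglinWaldspurger1995, I.2.1] -/
theorem levi_map_mem_ratH (hdV0 : ∀ i, dV i ≠ 0) (hdW0 : ∀ i, dW i ≠ 0) (γ : GL (Fin n) L) :
    Λ (Matrix.GeneralLinearGroup.map (algebraMap L (AdeleRing (𝓞 L) L)) γ) ∈ ratH L e dV hdV dW hdW :=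
  mem_ratH_of_blk_eq_levi_map L e dV hdV dW hdW hdV0 hdW0 γ (hΛ _)

include hΛ in
/-- **`Λ(x)` normalises `N_Δ(𝔸)`**: `Λ x · u · Λ x⁻¹ ∈ N_Δ(𝔸)` for `u ∈ N_Δ(𝔸)` (★ `conj_mem_unipDelta` at `p = Λ x⁻¹`).
[cite: MoeglinWaldspurger1995, I.2.1] -/
theorem conj_levi_mem_unipDelta (x : GL (Fin n) (AdeleRing (𝓞 L) L)) {u : HA L e dV hdV dW hdW} (hu : u ∈ unipDelta L e dV hdV dW hdW) :
    Λ x * u * (Λ x)⁻¹ ∈ unipDelta L e dV hdV dW hdW := by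
  have h := conj_mem_unipDelta L e dV hdV dW hdW (isSiegelDelta_levi_apply L e dV hdV dW hdW Λ hΛ x⁻¹) hu
  rwa [map_inv, inv_inv] at h

include hΛ in
/-- … and in the other direction: `Λ x⁻¹ · u · Λ x ∈ N_Δ(𝔸)`. [cite: MoeglinWaldspurger1995, I.2.1] -/
theorem inv_conj_levi_mem_unipDelta (x : GL (Fin n) (AdeleRing (𝓞 L) L)) {u : HA L e dV hdV dW hdW} (hu : u ∈ unipDelta L e dV hdV dW hdW) :
    (Λ x)⁻¹ * u * Λ x ∈ unipDelta L e dV hdV dW hdW :=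
  conj_mem_unipDelta L e dV hdV dW hdW (isSiegelDelta_levi_apply L e dV hdV dW hdW Λ hΛ x) hu

include hΛ in
/-- **`Λ(ĝ)`-conjugation preserves rationality**: for `g ∈ GL_n(L)`, `Λ ĝ · u · Λ ĝ⁻¹ ∈ H(L⁺) ↔ u ∈ H(L⁺)`. [cite: MoeglinWaldspurger1995, I.2.1] -/
theorem conj_levi_mem_ratH_iff (hdV0 : ∀ i, dV i ≠ 0) (hdW0 : ∀ i, dW i ≠ 0) (γ : GL (Fin n) L) (u : HA L e dV hdV dW hdW) :
    Λ (Matrix.GeneralLinearGroup.map (algebraMap L (AdeleRing (𝓞 L) L)) γ) * u *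
        (Λ (Matrix.GeneralLinearGroup.map (algebraMap L (AdeleRing (𝓞 L) L)) γ))⁻¹ ∈ ratH L e dV hdV dW hdW ↔
      u ∈ ratH L e dV hdV dW hdW := by
  have hx := levi_map_mem_ratH L e dV hdV dW hdW Λ hΛ hdV0 hdW0 γ
  refine ⟨fun h => ?_, fun h => mul_mem (mul_mem hx h) (inv_mem hx)⟩
  have h' := mul_mem (mul_mem (inv_mem hx) h) hx
  rwa [← mul_assoc, ← mul_assoc, inv_mul_cancel, one_mul, mul_assoc, inv_mul_cancel, mul_one] at h'

/-! ## 3. The rational Levi decomposition `P_Δ(L⁺) = N_Δ(L⁺) · Λ(GL_n(L))` -/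

include hΛ in
/-- **RATIONAL LEVI DECOMPOSITION**: every `p ∈ P_Δ(L⁺)` (rational and Siegel) is `p = ν · Λ(ĝ)` with `g ∈ GL_n(L)` and `ν ∈ N_Δ(L⁺)`; in fact
`ĝ = p|_Δ` (★ `exists_rat_levi_blocks`) and `ν = p · Λ(ĝ)⁻¹` acts trivially on `Δ`. [cite: MoeglinWaldspurger1995, I.2.1] [cite: HarrisKudlaSweet1996, §1 (1.12)] -/
theorem exists_unip_mul_levi_of_rat_siegel (hdV0 : ∀ i, dV i ≠ 0) (hdW0 : ∀ i, dW i ≠ 0) {p : HA L e dV hdV dW hdW}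
    (hp : IsSiegelDelta L e dV hdV dW hdW p) (hpr : p ∈ ratH L e dV hdV dW hdW) :
    ∃ (γ : GL (Fin n) L) (ν : HA L e dV hdV dW hdW), ν ∈ unipDelta L e dV hdV dW hdW ∧ ν ∈ ratH L e dV hdV dW hdW ∧
      p = ν * Λ (Matrix.GeneralLinearGroup.map (algebraMap L (AdeleRing (𝓞 L) L)) γ) := by
  obtain ⟨A₀, D₀, hA₀, hδ, -, -⟩ := exists_rat_levi_blocks L e dV hdV dW hdW hdV0 hdW0 hp hpr
  have hA₀u : IsUnit A₀ := (Matrix.isUnit_iff_isUnit_det A₀).2 hA₀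
  have hγ : ((hA₀u.unit : GL (Fin n) L) : Matrix (Fin n) (Fin n) L) = A₀ := hA₀u.unit_spec
  have hĝ : ((Matrix.GeneralLinearGroup.map (algebraMap L (AdeleRing (𝓞 L) L)) hA₀u.unit : GL (Fin n) (AdeleRing (𝓞 L) L)) :
      Matrix (Fin n) (Fin n) (AdeleRing (𝓞 L) L)) = A₀.map (algebraMap L (AdeleRing (𝓞 L) L)) := by
    have h : ((Matrix.GeneralLinearGroup.map (algebraMap L (AdeleRing (𝓞 L) L)) hA₀u.unit : GL (Fin n) (AdeleRing (𝓞 L) L)) :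
        Matrix (Fin n) (Fin n) (AdeleRing (𝓞 L) L)) = ((hA₀u.unit : GL (Fin n) L) : Matrix (Fin n) (Fin n) L).map (algebraMap L (AdeleRing (𝓞 L) L)) := rfl
    rw [h, hγ]
  have hx := levi_map_mem_ratH L e dV hdV dW hdW Λ hΛ hdV0 hdW0 hA₀u.unit
  have hq : IsSiegelDelta L e dV hdV dW hdW (Λ (Matrix.GeneralLinearGroup.map (algebraMap L (AdeleRing (𝓞 L) L)) hA₀u.unit))⁻¹ := by
    rw [← map_inv]
    exact isSiegelDelta_levi_apply L e dV hdV dW hdW Λ hΛ _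
  refine ⟨hA₀u.unit, p * (Λ (Matrix.GeneralLinearGroup.map (algebraMap L (AdeleRing (𝓞 L) L)) hA₀u.unit))⁻¹, ?_,
    mul_mem hpr (inv_mem hx), by rw [inv_mul_cancel_right]⟩
  refine mem_unipDelta_of_deltaBlock_eq_one L e dV hdV dW hdW hdV0 hdW0 (isSiegelDelta_mul L e dV hdV dW hdW hp hq) ?_
  rw [deltaBlock_mul L e dV hdV dW hdW hp hq, ← map_inv, deltaBlock_levi_apply L e dV hdV dW hdW Λ hΛ, hδ, ← hĝ, Matrix.coe_units_inv,
    Matrix.mul_nonsing_inv _ (Matrix.isUnits_det_units _)]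

include hΛ in
/-- … and `p = Λ(ĝ) · ν'` with `ν' = Λ(ĝ)⁻¹ ν Λ(ĝ) ∈ N_Δ(L⁺)` (`Λ` normalises `N_Δ`, ★ `conj_mem_unipDelta`). [cite: MoeglinWaldspurger1995, I.2.1] -/
theorem exists_levi_mul_unip_of_rat_siegel (hdV0 : ∀ i, dV i ≠ 0) (hdW0 : ∀ i, dW i ≠ 0) {p : HA L e dV hdV dW hdW}
    (hp : IsSiegelDelta L e dV hdV dW hdW p) (hpr : p ∈ ratH L e dV hdV dW hdW) :
    ∃ (γ : GL (Fin n) L) (ν : HA L e dV hdV dW hdW), ν ∈ unipDelta L e dV hdV dW hdW ∧ ν ∈ ratH L e dV hdV dW hdW ∧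
      p = Λ (Matrix.GeneralLinearGroup.map (algebraMap L (AdeleRing (𝓞 L) L)) γ) * ν := by
  obtain ⟨γ, ν, hνN, hνr, hpe⟩ := exists_unip_mul_levi_of_rat_siegel L e dV hdV dW hdW Λ hΛ hdV0 hdW0 hp hpr
  have hx := levi_map_mem_ratH L e dV hdV dW hdW Λ hΛ hdV0 hdW0 γ
  refine ⟨γ, (Λ (Matrix.GeneralLinearGroup.map (algebraMap L (AdeleRing (𝓞 L) L)) γ))⁻¹ * ν *
      Λ (Matrix.GeneralLinearGroup.map (algebraMap L (AdeleRing (𝓞 L) L)) γ),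
    inv_conj_levi_mem_unipDelta L e dV hdV dW hdW Λ hΛ _ hνN, mul_mem (mul_mem (inv_mem hx) hνr) hx, ?_⟩
  rw [hpe]
  simp only [← mul_assoc, mul_inv_cancel, one_mul]

end Levi

end Summit.HodgeConjecture.HodgeConjecture.Cruxes.HLiu418.K2LiuSiegelRationalLeviDecomposition

end
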